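import Summits.KontsevichZagierPeriods.Zeta5Search.Barrier.ConeGammaCuspSlopeLattice

/-!
# ζ(5) search — BARRIER: THE ORBIT-DIRECTION GAUGE — `σ(δ + c·s(a)) = σ(δ)`: the cusp slope is a function on the
transversal quotient `ℝ⁸/ℝ·s(a)`

HONEST FRAMING (cell `pub-zeta5`): systematic search; no irrationality claim unless kernel-certified. MODEL objects
under Brown–Zudilin's (28)+(30) accounting ([BZ22] = arXiv:2210.03391; (28) observed, not proved); nothing here is a
statement about `ζ(5)`, any `γ` of record, the cone's supremum (C2 OPEN) or the VALUE / SIGN of the cusp slope at a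
named direction (DATA of the cell); S-E stays CONJECTURED; records in print UNMOVED. Prover P2 g28, sequel (S) of
«HOMOGENEITY AND THE LATTICE GAP» (INBOX 2026-08-27 l.9328; lead/lit g38 GO l.9330: a third theorem-only file).

* **`cuspSlope_add_smul_sParam`** — `σ(δ + c•s(a)) = σ(δ)` for EVERY real `c`: Lemma B (`cuspSlope_spec`) at one common
  admissible scale (`admissible_of_le`) and the tree's `translateIntegral_add_smul_sParam` (`P(δ + c•s) = P(δ)`,
  periodicity of the orbit);
* `cuspSlope_smul_sParam` — `σ(c•s(a)) = 0`; `cuspSlope_eq_of_sub_eq_smul` — `δ − δ' = c•s(a) ⇒ σ(δ) = σ(δ')`;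
  `cuspSlope_smul_add_smul_sParam` — `σ(t•δ + c•s(a)) = t·σ(δ)` (`t > 0`): with `cuspSlope_smul`, `σ` is a degree-1
  function on the 7-dimensional transversal quotient — its sign structure lives on `S⁶`; the lane's gauge
  `v̂ = (0, v)` loses nothing.
Junction by junction the one-sided votes `K_b` shift by the coboundary `c·J_b` (`J_b` the orbit jump at `b`,
`Σ_b J_b = 0` over a period) and the symmetric votes `R_b` are gauge-invariant — DATA of the cell in this round
(`HOME/pub-zeta5-p2/g28/alg/gauge.py`: 0 failures on 54,870 (junction, v, c) triples at record/41, flag/60, argmax-120,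
t*/480), not a kernel statement here. NOT here (honest): any value at a named direction; anything about `γ` of record,
C2, S-E, `ζ(5)`.
-/

noncomputable section

open Set MeasureTheory
open scoped Topology

namespace Summit.KontsevichZagierPeriods.Zeta5Search.Barrier.ConeGamma

/-! ### `σ` lives on the transversal quotient `ℝ⁸/ℝ·s(a)` -/

/-- **`σ(δ + c•s(a)) = σ(δ)`** — displacing ALONG the orbit does not change the cusp slope: Lemma B (`cuspSlope_spec`)
at one common admissible scale `ρ` for `δ` and `δ + c•s(a)` (`admissible_of_le`) and the tree's
`translateIntegral_add_smul_sParam` (`P(ρ•δ + (ρc)•s(a)) = P(ρ•δ)`, periodicity of the orbit). So `σ` is a function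
of the TRANSVERSAL class of the displacement in `ℝ⁸/ℝ·s(a)` — the lane's gauge `v̂ = (0, v)` loses nothing — and,
with `cuspSlope_smul`, a degree-1 function there: its sign structure lives on `S⁶`. (Junction by junction the
one-sided votes `K_b` shift by the coboundary `c·J_b`, `J_b` the orbit jump at `b`, and the symmetric votes `R_b` are
gauge-invariant — DATA of the cell, `HOME/pub-zeta5-p2/g28/alg/gauge.py`, not a kernel statement here.) -/
theorem cuspSlope_add_smul_sParam {a : Dir} (hpos : ∀ k, 0 < h28 a k) {T : ℝ} (hT : 0 < T)
    (hper : ∀ k : Fin 28, ∃ z : ℤ, T * h28 a k = z) (δ : Fin 8 → ℝ) (c : ℝ) :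
    cuspSlope a T (δ + c • sParam a) = cuspSlope a T δ := by
  obtain ⟨ρ₁, hρ₁, h11, h12, hg1⟩ := exists_admissible_scale hpos hT (δ + c • sParam a)
  obtain ⟨ρ₂, hρ₂, h21, h22, hg2⟩ := exists_admissible_scale hpos hT δ
  obtain ⟨h1, h2, hg⟩ := admissible_of_le hpos (δ + c • sParam a) (min_le_left ρ₁ ρ₂) h11 h12 hg1
  obtain ⟨h1', h2', hg'⟩ := admissible_of_le hpos δ (min_le_right ρ₁ ρ₂) h21 h22 hg2
  have hρ : 0 < min ρ₁ ρ₂ := lt_min hρ₁ hρ₂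
  have e1 := cuspSlope_spec hpos hT hper (δ + c • sParam a) hρ h1 h2 hg
  have e2 := cuspSlope_spec hpos hT hper δ hρ h1' h2' hg'
  rw [smul_add, smul_smul, translateIntegral_add_smul_sParam hper, e2] at e1
  exact (mul_left_cancel₀ hρ.ne' e1).symm

/-- **`σ(c•s(a)) = 0`**: a displacement along the orbit produces no cusp. -/
theorem cuspSlope_smul_sParam {a : Dir} (hpos : ∀ k, 0 < h28 a k) {T : ℝ} (hT : 0 < T)
    (hper : ∀ k : Fin 28, ∃ z : ℤ, T * h28 a k = z) (c : ℝ) : cuspSlope a T (c • sParam a) = 0 := by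
  have h := cuspSlope_add_smul_sParam hpos hT hper 0 c
  rwa [zero_add, cuspSlope_zero] at h

/-- **Equal transversal classes have equal cusp slopes**: `δ − δ' = c•s(a) ⇒ σ(δ) = σ(δ')`. -/
theorem cuspSlope_eq_of_sub_eq_smul {a : Dir} (hpos : ∀ k, 0 < h28 a k) {T : ℝ} (hT : 0 < T)
    (hper : ∀ k : Fin 28, ∃ z : ℤ, T * h28 a k = z) {δ δ' : Fin 8 → ℝ} {c : ℝ} (h : δ - δ' = c • sParam a) :
    cuspSlope a T δ = cuspSlope a T δ' := by
  rw [show δ = δ' + c • sParam a by rw [← h]; abel]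
  exact cuspSlope_add_smul_sParam hpos hT hper δ' c

/-- **Degree 1 on the transversal quotient**: `σ(t•δ + c•s(a)) = t·σ(δ)` for `t > 0` and every real `c`. -/
theorem cuspSlope_smul_add_smul_sParam {a : Dir} (hpos : ∀ k, 0 < h28 a k) {T : ℝ} (hT : 0 < T)
    (hper : ∀ k : Fin 28, ∃ z : ℤ, T * h28 a k = z) (δ : Fin 8 → ℝ) {t : ℝ} (ht : 0 < t) (c : ℝ) :
    cuspSlope a T (t • δ + c • sParam a) = t * cuspSlope a T δ := by
  rw [cuspSlope_add_smul_sParam hpos hT hper (t • δ) c, cuspSlope_smul hpos hT hper δ ht]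

end Summit.KontsevichZagierPeriods.Zeta5Search.Barrier.ConeGamma

end
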